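import Summits.CriticalPhenomena.PercolationContinuityZ3.Theorems.PercNearOneGluingNoHeavyLowerTailApexTwoSumGlue
import HarnessLib

/-!
# `NoHeavyLowerTail` (stmt-CriticalPhenomena-4575) — FOLDING A TERMINAL-FREE TWO-TERMINAL NETWORK, part 1:
# clusters and support separation see a network between `u` and `v` only through the bit `[u ~ v inside]`

Support file (prover prim-gen-kcluster gen 72; `--supports stmt-CriticalPhenomena-4575`).  Pure graph combinatorics: no measures,
no definitions, no named facts, no sorries.  SETTING (KCLUSTER-gen57 §3.2 / gen69 §5.2: hub pairs `{u, v}` with a bridge containing none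
of `a, b, c`).  A NETWORK is a pair set `ζ_X` (inside a support `DX`) whose vertices other than the POLES `u, v` are INNER: they lie on no
pair of the rest `ζ_Y` (gluing hypothesis) and differ from the vertices `x, y, a, b, c` looked at (these lie on pairs of `DX` only as poles).
* `NetworkFold.mem_cl_of_network`, `mem_cl_replace` — for non-inner `x, y`: `y ∈ cl (ζ_X ∪ ζ_Y) x ↔ y ∈ cl (ζ_X' ∪ ζ_Y) x` for any two
  networks with `J(ζ_X) ↔ J(ζ_X')`, `J = [v ∈ C_X(u)]` (projection of the inner vertices onto the poles; edges go to reachable pairs);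
* `NetworkFold.not_inner_of_mem_cl` — if neither pole is in `C(a)` then `C(a)` contains no inner vertex;
* `NetworkFold.sep_replace` — inside CONNECTED supports (`v ∈ cl DX u`, `v ∈ cl DX' u`) and with `J(ζ_X) ↔ J(ζ_X')`:
  `Sep (DX ∪ DY) (cl (ζ_X ∪ ζ_Y) a) b c ↔ Sep (DX' ∪ DY) (cl (ζ_X' ∪ ζ_Y) a) b c`;
* event forms for the blocks `ω ∩ DX`, `ω ∖ DX` against the SINGLE-EDGE network `{s(u,v)}` (`mem_cl_iff_of_J / _of_not_J`,
  `sep_iff_of_J / _of_not_J`): the replaced configuration is `insert s(u,v) (ω ∖ DX)` when `J`, `ω ∖ DX` otherwise.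
Part 2 (`…NetworkFold`): the exact folding identity of `φ_{𝐩,q}` (every `q > 0`) — the three-point cells keep their probabilities when the
network is replaced by one edge `uv` of parameter `X₁/(X₀ + X₁)` (Fortuin–Kasteleyn series/parallel laws in general form).
-/


namespace Summit.CriticalPhenomena.PercolationContinuityZ3.Theorems

namespace NetworkFold

open SimpleGraph Finset Literature.Probability.Percolation Literature.Probability.Percolation.Gladkov
open Literature.Probability.LatticeModels RefinedRowR3 ThreePointLB APL
open scoped Classical

variable {V : Type*}

/-! ### Projection with reachable images -/

/-- If a vertex map sends every edge of `G` to a reachable pair of `H`, it sends `G`-reachable pairs to `H`-reachable pairs. [folklore] -/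
theorem reachable_map_of_adj {G H : SimpleGraph V} (ρ : V → V)
    (step : ∀ z z', G.Adj z z' → H.Reachable (ρ z) (ρ z')) {x y : V} (h : G.Reachable x y) :
    H.Reachable (ρ x) (ρ y) := by
  obtain ⟨p⟩ := h
  induction p with
  | nil => exact Reachable.refl _
  | @cons z₁ z₂ z₃ h₁₂ _ ih => exact (step z₁ z₂ h₁₂).trans ih

variable [Fintype V]

/-! ### Replacing a network -/

section Replace

variable {ζX ζX' ζY : Finset (Sym2 V)} {u v x y : V}

/-- **A network is seen only through `[v ∈ C_X(u)]`** (one direction, any target `T ⊇ ζ_Y` joining the poles whenever the network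
does): for non-inner `x, y`, `y ∈ cl (ζ_X ∪ ζ_Y) x → y ∈ cl T x` (project inner vertices of `C_X(v)` to `v`, the others to `u`). [this work] -/
theorem mem_cl_of_network {T : Finset (Sym2 V)} (hYT : ζY ⊆ T)
    (hsep : ∀ z : V, (∃ e ∈ ζX, z ∈ e) → (∃ e ∈ ζY, z ∈ e) → (z = u ∨ z = v))
    (hx : ∀ e ∈ ζX, x ∈ e → (x = u ∨ x = v)) (hy : ∀ e ∈ ζX, y ∈ e → (y = u ∨ y = v))
    (hJ : v ∈ cl ζX u → v ∈ cl T u) (h : y ∈ cl (ζX ∪ ζY) x) : y ∈ cl T x := by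
  rw [mem_cl] at h ⊢
  -- the projection
  set ρ : V → V := fun z =>
    if (∃ e ∈ ζX, z ∈ e) ∧ z ≠ u ∧ z ≠ v then (if z ∈ cl ζX v then v else u) else z with hρ
  have hfix : ∀ z, (∀ e ∈ ζX, z ∈ e → (z = u ∨ z = v)) → ρ z = z := by
    intro z hz
    simp only [hρ]
    rw [if_neg]
    exact fun ⟨⟨e, he, hze⟩, hzu, hzv⟩ => (hz e he hze).elim hzu hzv
  have key := reachable_map_of_adj (G := openGraph (↑(ζX ∪ ζY) : Set (Sym2 V)))
    (H := openGraph (↑T : Set (Sym2 V))) ρ ?_ h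
  · rwa [hfix x hx, hfix y hy] at key
  -- one step of the projection
  intro z z' hzz'
  rw [openGraph_adj, Finset.mem_coe, Finset.mem_union] at hzz'
  obtain ⟨hXY, hne⟩ := hzz'
  rcases hXY with hX | hY
  · -- a pair of the network: both images are poles
    have hform : ∀ t, t ∈ s(z, z') → ρ t = (if t ∈ cl ζX v ∧ t ≠ u then v else u) := by
      intro t ht
      simp only [hρ]
      by_cases htu : t = u
      · rw [if_neg (fun h => h.2.1 htu), if_neg (fun h => h.2 htu), htu]
      by_cases htv : t = v
      · subst htv
        rw [if_neg (fun h => h.2.2 rfl), if_pos ⟨mem_cl_self _ _, htu⟩]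
      · rw [if_pos ⟨⟨_, hX, ht⟩, htu, htv⟩]
        by_cases hc : t ∈ cl ζX v
        · rw [if_pos hc, if_pos ⟨hc, htu⟩]
        · rw [if_neg hc, if_neg (fun h => hc h.1)]
    have hadj : (openGraph (↑ζX : Set (Sym2 V))).Adj z z' := by
      rw [openGraph_adj, Finset.mem_coe]; exact ⟨hX, hne⟩
    have hzz'cl : z ∈ cl ζX v ↔ z' ∈ cl ζX v :=
      ⟨fun hz => mem_cl_of_adj hz hadj, fun hz' => mem_cl_of_adj hz' hadj.symm⟩
    rw [hform z (Sym2.mem_mk_left z z'), hform z' (Sym2.mem_mk_right z z')]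
    by_cases hJ0 : u ∈ cl ζX v
    · -- the poles are joined in the network, hence in the target
      have hT : (openGraph (↑T : Set (Sym2 V))).Reachable u v := by
        rw [← mem_cl]; exact hJ (mem_cl_comm.1 hJ0)
      split_ifs
      · exact Reachable.refl _
      · exact hT.symm
      · exact hT
      · exact Reachable.refl _
    · -- otherwise the two images coincide
      have h1 : (z ∈ cl ζX v ∧ z ≠ u) ↔ (z' ∈ cl ζX v ∧ z' ≠ u) :=
        ⟨fun ⟨hz, _⟩ => ⟨hzz'cl.1 hz, fun h => hJ0 (h ▸ hzz'cl.1 hz)⟩,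
          fun ⟨hz', _⟩ => ⟨hzz'cl.2 hz', fun h => hJ0 (h ▸ hzz'cl.2 hz')⟩⟩
      by_cases hc : z ∈ cl ζX v ∧ z ≠ u
      · rw [if_pos hc, if_pos (h1.1 hc)]
      · rw [if_neg hc, if_neg (fun h => hc (h1.2 h))]
  · -- a pair of the rest: both endpoints are fixed
    have hfixY : ∀ t, t ∈ s(z, z') → ρ t = t := fun t ht =>
      hfix t (fun e he hte => hsep t ⟨e, he, hte⟩ ⟨_, hY, ht⟩)
    rw [hfixY z (Sym2.mem_mk_left z z'), hfixY z' (Sym2.mem_mk_right z z')]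
    refine Adj.reachable ?_
    rw [openGraph_adj, Finset.mem_coe]; exact ⟨hYT hY, hne⟩
/-- **Replacing a network by another with the same bit `[v ∈ C_X(u)]` does not change the clusters of non-inner vertices.** [this work] -/
theorem mem_cl_replace
    (hsep : ∀ z : V, (∃ e ∈ ζX, z ∈ e) → (∃ e ∈ ζY, z ∈ e) → (z = u ∨ z = v))
    (hsep' : ∀ z : V, (∃ e ∈ ζX', z ∈ e) → (∃ e ∈ ζY, z ∈ e) → (z = u ∨ z = v))
    (hx : ∀ e ∈ ζX, x ∈ e → (x = u ∨ x = v)) (hx' : ∀ e ∈ ζX', x ∈ e → (x = u ∨ x = v))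
    (hy : ∀ e ∈ ζX, y ∈ e → (y = u ∨ y = v)) (hy' : ∀ e ∈ ζX', y ∈ e → (y = u ∨ y = v))
    (hJ : v ∈ cl ζX u ↔ v ∈ cl ζX' u) :
    y ∈ cl (ζX ∪ ζY) x ↔ y ∈ cl (ζX' ∪ ζY) x :=
  ⟨mem_cl_of_network Finset.subset_union_right hsep hx hy
      (fun h => cl_mono Finset.subset_union_left u (hJ.1 h)),
    mem_cl_of_network Finset.subset_union_right hsep' hx' hy'
      (fun h => cl_mono Finset.subset_union_left u (hJ.2 h))⟩

/-- **If neither pole is in the cluster of a non-inner vertex, the cluster contains no inner vertex of the network.**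
(Along an open path from `a` the first inner vertex is entered through a pole.) [this work] -/
theorem not_inner_of_mem_cl
    (hsep : ∀ z : V, (∃ e ∈ ζX, z ∈ e) → (∃ e ∈ ζY, z ∈ e) → (z = u ∨ z = v))
    {a : V} (ha : ∀ e ∈ ζX, a ∈ e → (a = u ∨ a = v))
    (hu : u ∉ cl (ζX ∪ ζY) a) (hv : v ∉ cl (ζX ∪ ζY) a) {z : V} (hz : z ∈ cl (ζX ∪ ζY) a) :
    ∀ e ∈ ζX, z ∈ e → (z = u ∨ z = v) := by
  have key : ∀ (s t : V) (p : (openGraph (↑(ζX ∪ ζY) : Set (Sym2 V))).Walk s t),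
      (∀ e ∈ ζX, s ∈ e → (s = u ∨ s = v)) → (¬ ∀ e ∈ ζX, t ∈ e → (t = u ∨ t = v)) →
      ((openGraph (↑(ζX ∪ ζY) : Set (Sym2 V))).Reachable s u ∨
        (openGraph (↑(ζX ∪ ζY) : Set (Sym2 V))).Reachable s v) := by
    intro s t p
    induction p with
    | nil => intro hs ht; exact absurd hs ht
    | @cons s₁ s₂ s₃ h₁₂ _ ih =>
      intro hs ht
      by_cases hs₂ : ∀ e ∈ ζX, s₂ ∈ e → (s₂ = u ∨ s₂ = v)
      · rcases ih hs₂ ht with h | h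
        · exact Or.inl (h₁₂.reachable.trans h)
        · exact Or.inr (h₁₂.reachable.trans h)
      · -- `s₂` is inner: the pair `s₁ s₂` is a network pair and `s₁` is a pole
        have h12 := h₁₂
        rw [openGraph_adj, Finset.mem_coe, Finset.mem_union] at h12
        obtain ⟨hXY, -⟩ := h12
        push Not at hs₂
        obtain ⟨e, he, hs₂e, hs₂u, hs₂v⟩ := hs₂
        rcases hXY with hX | hY
        · rcases hs _ hX (Sym2.mem_mk_left s₁ s₂) with rfl | rfl
          · exact Or.inl (Reachable.refl _)
          · exact Or.inr (Reachable.refl _)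
        · exact ((hsep s₂ ⟨e, he, hs₂e⟩ ⟨_, hY, Sym2.mem_mk_right s₁ s₂⟩).elim hs₂u hs₂v).elim
  by_contra hzX
  obtain ⟨p⟩ := mem_cl.1 hz
  rcases key a z p ha hzX with h | h
  · exact hu (mem_cl.2 h)
  · exact hv (mem_cl.2 h)

end Replace

/-! ### Support separation -/

section Separation

variable {DX DX' DY ζX ζX' ζY : Finset (Sym2 V)} {u v a b c : V}

/-- **Replacing a network inside a connected support preserves support separation** (one direction; off the two clusters, which agree
on non-inner vertices, the supports are again two networks glued to the same rest, with the same bit). [this work] -/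
theorem sep_replace_imp (huv : u ≠ v)
    (hsepD : ∀ z : V, (∃ e ∈ DX, z ∈ e) → (∃ e ∈ DY, z ∈ e) → (z = u ∨ z = v))
    (hsepD' : ∀ z : V, (∃ e ∈ DX', z ∈ e) → (∃ e ∈ DY, z ∈ e) → (z = u ∨ z = v))
    (hζX : ζX ⊆ DX) (hζX' : ζX' ⊆ DX') (hζY : ζY ⊆ DY)
    (ha : ∀ e ∈ DX, a ∈ e → (a = u ∨ a = v)) (ha' : ∀ e ∈ DX', a ∈ e → (a = u ∨ a = v))
    (hb : ∀ e ∈ DX, b ∈ e → (b = u ∨ b = v)) (hc : ∀ e ∈ DX, c ∈ e → (c = u ∨ c = v))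
    (hN' : v ∈ cl DX' u) (hJ : v ∈ cl ζX u ↔ v ∈ cl ζX' u)
    (h : Sep (DX' ∪ DY) (cl (ζX' ∪ ζY) a) b c) : Sep (DX ∪ DY) (cl (ζX ∪ ζY) a) b c := by
  set W := cl (ζX ∪ ζY) a with hW
  set W' := cl (ζX' ∪ ζY) a with hW'
  have hsep : ∀ z : V, (∃ e ∈ ζX, z ∈ e) → (∃ e ∈ ζY, z ∈ e) → (z = u ∨ z = v) :=
    fun z ⟨e, he, hze⟩ ⟨e', he', hze'⟩ => hsepD z ⟨e, hζX he, hze⟩ ⟨e', hζY he', hze'⟩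
  have hsep' : ∀ z : V, (∃ e ∈ ζX', z ∈ e) → (∃ e ∈ ζY, z ∈ e) → (z = u ∨ z = v) :=
    fun z ⟨e, he, hze⟩ ⟨e', he', hze'⟩ => hsepD' z ⟨e, hζX' he, hze⟩ ⟨e', hζY he', hze'⟩
  -- (i) the two clusters agree on vertices that are inner for neither support
  have hWW : ∀ z, (∀ e ∈ DX, z ∈ e → (z = u ∨ z = v)) → (∀ e ∈ DX', z ∈ e → (z = u ∨ z = v)) →
      (z ∈ W ↔ z ∈ W') := fun z hz hz' =>
    mem_cl_replace hsep hsep' (fun e he => ha e (hζX he)) (fun e he => ha' e (hζX' he))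
      (fun e he => hz e (hζX he)) (fun e he => hz' e (hζX' he)) hJ
  -- (ii) hence the rest off the cluster is the same on both sides
  have hEY : DY \ touch W' = DY \ touch W := by
    ext e
    simp only [Finset.mem_sdiff, mem_touch, not_exists, not_and]
    constructor
    · rintro ⟨he, h1⟩
      refine ⟨he, fun z hzW hze => h1 z ?_ hze⟩
      exact (hWW z (fun f hf hzf => hsepD z ⟨f, hf, hzf⟩ ⟨e, he, hze⟩)
        (fun f hf hzf => hsepD' z ⟨f, hf, hzf⟩ ⟨e, he, hze⟩)).1 hzW
    · rintro ⟨he, h1⟩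
      refine ⟨he, fun z hzW' hze => h1 z ?_ hze⟩
      exact (hWW z (fun f hf hzf => hsepD z ⟨f, hf, hzf⟩ ⟨e, he, hze⟩)
        (fun f hf hzf => hsepD' z ⟨f, hf, hzf⟩ ⟨e, he, hze⟩)).2 hzW'
  unfold RefinedRowR3.Sep at h ⊢
  rw [Finset.union_sdiff_distrib] at h ⊢
  rw [hEY] at h
  intro hcb
  apply h
  -- transport `c ∈ cl ((DX ∖ touch W) ∪ (DY ∖ touch W)) b` to the primed side
  refine mem_cl_of_network (ζX := DX \ touch W) (ζY := DY \ touch W) (u := u) (v := v) Finset.subset_union_right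
    ?_ ?_ ?_ ?_ hcb
  · rintro z ⟨e, he, hze⟩ ⟨e', he', hze'⟩
    exact hsepD z ⟨e, (Finset.mem_sdiff.1 he).1, hze⟩ ⟨e', (Finset.mem_sdiff.1 he').1, hze'⟩
  · exact fun e he hbe => hb e (Finset.mem_sdiff.1 he).1 hbe
  · exact fun e he hce => hc e (Finset.mem_sdiff.1 he).1 hce
  · -- the bit: if the poles are joined off `W` in `DX`, then no pole is in `W`, hence none in `W'`, and `DX'` survives whole
    intro hJW
    have huW : u ∉ W := by
      intro huW
      have h0 : ∀ e ∈ DX \ touch W, u ∉ e := fun e he hue =>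
        (Finset.mem_sdiff.1 he).2 (mem_touch.2 ⟨u, huW, hue⟩)
      exact huv (ApexTwoSum.eq_of_mem_cl_of_forall_not_mem h0 hJW).symm
    have hvW : v ∉ W := by
      intro hvW
      obtain ⟨e, he, hve⟩ := exists_mem_edge_of_mem_cl hJW huv.symm
      exact (Finset.mem_sdiff.1 he).2 (mem_touch.2 ⟨v, hvW, hve⟩)
    have huW' : u ∉ W' := fun h' => huW ((hWW u (fun _ _ _ => Or.inl rfl) (fun _ _ _ => Or.inl rfl)).2 h')
    have hvW' : v ∉ W' := fun h' => hvW ((hWW v (fun _ _ _ => Or.inr rfl) (fun _ _ _ => Or.inr rfl)).2 h')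
    -- no pair of `DX'` touches `W'`
    have hDX' : DX' \ touch W' = DX' := by
      refine Finset.sdiff_eq_self_of_disjoint (Finset.disjoint_left.2 fun e he heT => ?_)
      obtain ⟨z, hzW', hze⟩ := mem_touch.1 heT
      -- `z` is a pole or inner for `DX'`; poles are excluded, inner vertices too
      have hzX' : ∀ f ∈ ζX', z ∈ f → (z = u ∨ z = v) :=
        not_inner_of_mem_cl hsep' (fun f hf => ha' f (hζX' hf)) huW' hvW' hzW'
      have hza : z ≠ a := by
        rintro rfl
        rcases ha' e he hze with h' | h'
        · exact huW' (h' ▸ hzW')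
        · exact hvW' (h' ▸ hzW')
      obtain ⟨f, hf, hzf⟩ := exists_mem_edge_of_mem_cl hzW' hza
      have hzp : z = u ∨ z = v := (Finset.mem_union.1 hf).elim (fun hfX => hzX' f hfX hzf)
        (fun hfY => hsepD' z ⟨e, he, hze⟩ ⟨f, hζY hfY, hzf⟩)
      exact hzp.elim (fun h' => huW' (h' ▸ hzW')) (fun h' => hvW' (h' ▸ hzW'))
    rw [hDX']
    exact cl_mono Finset.subset_union_left u hN'

/-- **Replacing a network inside connected supports preserves support separation.** [this work] -/
theorem sep_replace (huv : u ≠ v)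
    (hsepD : ∀ z : V, (∃ e ∈ DX, z ∈ e) → (∃ e ∈ DY, z ∈ e) → (z = u ∨ z = v))
    (hsepD' : ∀ z : V, (∃ e ∈ DX', z ∈ e) → (∃ e ∈ DY, z ∈ e) → (z = u ∨ z = v))
    (hζX : ζX ⊆ DX) (hζX' : ζX' ⊆ DX') (hζY : ζY ⊆ DY)
    (ha : ∀ e ∈ DX, a ∈ e → (a = u ∨ a = v)) (ha' : ∀ e ∈ DX', a ∈ e → (a = u ∨ a = v))
    (hb : ∀ e ∈ DX, b ∈ e → (b = u ∨ b = v)) (hb' : ∀ e ∈ DX', b ∈ e → (b = u ∨ b = v))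
    (hc : ∀ e ∈ DX, c ∈ e → (c = u ∨ c = v)) (hc' : ∀ e ∈ DX', c ∈ e → (c = u ∨ c = v))
    (hN : v ∈ cl DX u) (hN' : v ∈ cl DX' u) (hJ : v ∈ cl ζX u ↔ v ∈ cl ζX' u) :
    Sep (DX ∪ DY) (cl (ζX ∪ ζY) a) b c ↔ Sep (DX' ∪ DY) (cl (ζX' ∪ ζY) a) b c :=
  ⟨sep_replace_imp huv hsepD' hsepD hζX' hζX hζY ha' ha hb' hc' hN hJ.symm,
    sep_replace_imp huv hsepD hsepD' hζX hζX' hζY ha ha' hb hc hN' hJ⟩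

end Separation

/-! ### Event forms against the single-edge network -/

section Events

variable {DX DY : Finset (Sym2 V)} {u v a b c : V} (huv : u ≠ v)
  (hsepD : ∀ z : V, (∃ e ∈ DX, z ∈ e) → (∃ e ∈ DY, z ∈ e) → (z = u ∨ z = v))

omit [Fintype V] in
/-- The single pair `s(u,v)` glues to anything at its poles. [folklore] -/
theorem hsep_single (S : Finset (Sym2 V)) :
    ∀ z : V, (∃ e ∈ ({s(u, v)} : Finset (Sym2 V)), z ∈ e) → (∃ e ∈ S, z ∈ e) → (z = u ∨ z = v) := by
  rintro z ⟨e, he, hze⟩ -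
  rw [Finset.mem_singleton] at he
  subst he
  exact Sym2.mem_iff.1 hze

omit [Fintype V] in
/-- The single pair `s(u,v)` has no inner vertices. [folklore] -/
theorem not_inner_single (x : V) : ∀ e ∈ ({s(u, v)} : Finset (Sym2 V)), x ∈ e → (x = u ∨ x = v) := by
  intro e he hxe
  rw [Finset.mem_singleton] at he
  subst he
  exact Sym2.mem_iff.1 hxe

include huv in
/-- The single pair joins its poles. [folklore] -/
theorem mem_cl_single : v ∈ cl ({s(u, v)} : Finset (Sym2 V)) u :=
  mem_cl_of_adj (mem_cl_self _ u) (by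
    rw [openGraph_adj, Finset.mem_coe]; exact ⟨Finset.mem_singleton_self _, huv⟩)

include huv in
/-- The empty network does not join distinct poles. [folklore] -/
theorem not_mem_cl_empty : v ∉ cl (∅ : Finset (Sym2 V)) u := fun h =>
  huv (ApexTwoSum.eq_of_mem_cl_of_forall_not_mem (fun e he _ => absurd he (Finset.notMem_empty e)) h).symm

include huv hsepD in
/-- **Event form, `J` holds**: for non-inner `x, y` and `ω ⊆ DX ∪ DY` whose network block joins the poles,
`y ∈ C(x)` in `ω` iff in `insert s(u,v) (ω ∖ DX)`. [this work] -/
theorem mem_cl_iff_of_J {x y : V} (hx : ∀ e ∈ DX, x ∈ e → (x = u ∨ x = v)) (hy : ∀ e ∈ DX, y ∈ e → (y = u ∨ y = v))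
    {ω : BondConfig V} (hω : ω ⊆ ↑DX ∪ ↑DY) (hJ : (ω ∩ ↑DX) ∈ {η : BondConfig V | v ∈ cl η.toFinset u}) :
    y ∈ cl ω.toFinset x ↔ insert s(u, v) (ω \ ↑DX) ∈ {η : BondConfig V | y ∈ cl η.toFinset x} := by
  simp only [Set.mem_setOf_eq] at hJ ⊢
  suffices key : ∀ ζX ζY ζ : Finset (Sym2 V), (∀ e, e ∈ ζX ↔ e ∈ ω ∩ (↑DX : Set (Sym2 V))) →
      (∀ e, e ∈ ζY ↔ e ∈ ω \ (↑DX : Set (Sym2 V))) → (∀ e, e ∈ ζ ↔ e ∈ insert s(u, v) (ω \ (↑DX : Set (Sym2 V)))) →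
      v ∈ cl ζX u → (y ∈ cl ω.toFinset x ↔ y ∈ cl ζ x) by
    refine key _ (ω \ (↑DX : Set (Sym2 V))).toFinset _ ?_ (fun e => by simp only [Set.mem_toFinset]) ?_ hJ
    · intro e; simp only [Set.mem_toFinset]
    · intro e; simp only [Set.mem_toFinset]
  intro ζX ζY ζ hX hY hζ hJζ
  obtain ⟨hωζ, hXD, -, hsep⟩ := ApexTwoSum.blocks_of_eq hsepD hω hX hY
  have hζ' : ζ = {s(u, v)} ∪ ζY := by
    ext e
    rw [hζ, Finset.mem_union, Finset.mem_singleton, hY, Set.mem_insert_iff]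
  rw [hωζ, hζ']
  exact mem_cl_replace hsep (hsep_single ζY) (fun e he => hx e (hXD he)) (not_inner_single x)
    (fun e he => hy e (hXD he)) (not_inner_single y) ⟨fun _ => mem_cl_single huv, fun _ => hJζ⟩

include huv hsepD in
/-- **Event form, `J` fails**: for non-inner `x, y` and `ω ⊆ DX ∪ DY` whose network block does not join the poles,
`y ∈ C(x)` in `ω` iff in `ω ∖ DX`. [this work] -/
theorem mem_cl_iff_of_not_J {x y : V} (hx : ∀ e ∈ DX, x ∈ e → (x = u ∨ x = v)) (hy : ∀ e ∈ DX, y ∈ e → (y = u ∨ y = v))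
    {ω : BondConfig V} (hω : ω ⊆ ↑DX ∪ ↑DY) (hJ : (ω ∩ ↑DX) ∉ {η : BondConfig V | v ∈ cl η.toFinset u}) :
    y ∈ cl ω.toFinset x ↔ (ω \ ↑DX) ∈ {η : BondConfig V | y ∈ cl η.toFinset x} := by
  simp only [Set.mem_setOf_eq] at hJ ⊢
  suffices key : ∀ ζX ζY : Finset (Sym2 V), (∀ e, e ∈ ζX ↔ e ∈ ω ∩ (↑DX : Set (Sym2 V))) →
      (∀ e, e ∈ ζY ↔ e ∈ ω \ (↑DX : Set (Sym2 V))) → v ∉ cl ζX u → (y ∈ cl ω.toFinset x ↔ y ∈ cl ζY x) by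
    refine key _ _ ?_ (fun e => by simp only [Set.mem_toFinset]) hJ
    intro e; simp only [Set.mem_toFinset]
  intro ζX ζY hX hY hJζ
  obtain ⟨hωζ, hXD, -, hsep⟩ := ApexTwoSum.blocks_of_eq hsepD hω hX hY
  rw [hωζ]
  have key := mem_cl_replace (ζX' := (∅ : Finset (Sym2 V))) hsep (fun z ⟨e, he, _⟩ _ => absurd he (Finset.notMem_empty e))
    (fun e he => hx e (hXD he)) (fun e he _ => absurd he (Finset.notMem_empty e))
    (fun e he => hy e (hXD he)) (fun e he _ => absurd he (Finset.notMem_empty e))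
    ⟨fun h => absurd h hJζ, fun h => absurd h (not_mem_cl_empty huv)⟩
  rwa [Finset.empty_union] at key

include huv hsepD in
/-- **Event form of the separation rule, `J` holds.** [this work] -/
theorem sep_iff_of_J (ha : ∀ e ∈ DX, a ∈ e → (a = u ∨ a = v)) (hb : ∀ e ∈ DX, b ∈ e → (b = u ∨ b = v))
    (hc : ∀ e ∈ DX, c ∈ e → (c = u ∨ c = v)) (hN : v ∈ cl DX u)
    {ω : BondConfig V} (hω : ω ⊆ ↑DX ∪ ↑DY) (hJ : (ω ∩ ↑DX) ∈ {η : BondConfig V | v ∈ cl η.toFinset u}) :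
    Sep (DX ∪ DY) (cl ω.toFinset a) b c ↔
      insert s(u, v) (ω \ ↑DX) ∈ {η : BondConfig V | Sep ({s(u, v)} ∪ DY) (cl η.toFinset a) b c} := by
  simp only [Set.mem_setOf_eq] at hJ ⊢
  suffices key : ∀ ζX ζY ζ : Finset (Sym2 V), (∀ e, e ∈ ζX ↔ e ∈ ω ∩ (↑DX : Set (Sym2 V))) →
      (∀ e, e ∈ ζY ↔ e ∈ ω \ (↑DX : Set (Sym2 V))) → (∀ e, e ∈ ζ ↔ e ∈ insert s(u, v) (ω \ (↑DX : Set (Sym2 V)))) →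
      v ∈ cl ζX u → (Sep (DX ∪ DY) (cl ω.toFinset a) b c ↔ Sep ({s(u, v)} ∪ DY) (cl ζ a) b c) by
    refine key _ (ω \ (↑DX : Set (Sym2 V))).toFinset _ ?_ (fun e => by simp only [Set.mem_toFinset]) ?_ hJ
    · intro e; simp only [Set.mem_toFinset]
    · intro e; simp only [Set.mem_toFinset]
  intro ζX ζY ζ hX hY hζ hJζ
  obtain ⟨hωζ, hXD, hYD, hsep⟩ := ApexTwoSum.blocks_of_eq hsepD hω hX hY
  have hζ' : ζ = {s(u, v)} ∪ ζY := by
    ext e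
    rw [hζ, Finset.mem_union, Finset.mem_singleton, hY, Set.mem_insert_iff]
  rw [hωζ, hζ']
  exact sep_replace huv hsepD (hsep_single DY) hXD (subset_refl _) hYD ha (not_inner_single a) hb (not_inner_single b)
    hc (not_inner_single c) hN (mem_cl_single huv) ⟨fun _ => mem_cl_single huv, fun _ => hJζ⟩

include huv hsepD in
/-- **Event form of the separation rule, `J` fails.** [this work] -/
theorem sep_iff_of_not_J (ha : ∀ e ∈ DX, a ∈ e → (a = u ∨ a = v)) (hb : ∀ e ∈ DX, b ∈ e → (b = u ∨ b = v))
    (hc : ∀ e ∈ DX, c ∈ e → (c = u ∨ c = v)) (hN : v ∈ cl DX u)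
    {ω : BondConfig V} (hω : ω ⊆ ↑DX ∪ ↑DY) (hJ : (ω ∩ ↑DX) ∉ {η : BondConfig V | v ∈ cl η.toFinset u}) :
    Sep (DX ∪ DY) (cl ω.toFinset a) b c ↔
      (ω \ ↑DX) ∈ {η : BondConfig V | Sep ({s(u, v)} ∪ DY) (cl η.toFinset a) b c} := by
  simp only [Set.mem_setOf_eq] at hJ ⊢
  suffices key : ∀ ζX ζY : Finset (Sym2 V), (∀ e, e ∈ ζX ↔ e ∈ ω ∩ (↑DX : Set (Sym2 V))) →
      (∀ e, e ∈ ζY ↔ e ∈ ω \ (↑DX : Set (Sym2 V))) → v ∉ cl ζX u →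
      (Sep (DX ∪ DY) (cl ω.toFinset a) b c ↔ Sep ({s(u, v)} ∪ DY) (cl ζY a) b c) by
    refine key _ _ ?_ (fun e => by simp only [Set.mem_toFinset]) hJ
    intro e; simp only [Set.mem_toFinset]
  intro ζX ζY hX hY hJζ
  obtain ⟨hωζ, hXD, hYD, hsep⟩ := ApexTwoSum.blocks_of_eq hsepD hω hX hY
  rw [hωζ]
  have key := sep_replace (ζX' := (∅ : Finset (Sym2 V))) huv hsepD (hsep_single DY) hXD (Finset.empty_subset _) hYD
    ha (not_inner_single a) hb (not_inner_single b) hc (not_inner_single c) hN (mem_cl_single huv)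
    ⟨fun h => absurd h hJζ, fun h => absurd h (not_mem_cl_empty huv)⟩
  rwa [Finset.empty_union] at key

end Events

end NetworkFold

end Summit.CriticalPhenomena.PercolationContinuityZ3.Theorems
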